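import Literature.Probability.Percolation.QuadCrossingExplorationJointDecoupling
import HarnessLib

/-!
# Schramm–Smirnov Lemma 6.1, case (2): tame quads WITHOUT the cut point

Topic `Probability/Percolation`; proofs file towards the named fact `SchrammSmirnov2011_lemma_6_1`
(`QuadCrossingContinuity.lean`; O. Schramm, S. Smirnov, *On the scaling limits of planar
percolation*, Ann. Probab. 39 (2011) 1768–1814, arXiv:1101.5820, Lemma 6.1 (2) and its proof,
pp. 21–23).

`QuadCrossingContinuityCaseTwoTame.lean` proves the product form of the case-(2) estimate under four
hypotheses on the pair `(Q, Q')`: lattice tameness of `[Q]` (T1), Schramm–Smirnov's cut point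
`z ∈ ∂₂Q'` (T2), the chord–arc free side (T3) and local star-shapedness at free-side points (T4).
This file REMOVES the cut point (T2), which need not exist for a general free side: the bad event
`⊞_{Q'} ∖ ⊞_Q` is split according to whether the landing point `x` of the lowest crossing is far
from `∂₃Q` (the printed argument, `Charts.measureReal_crossed_not_crossed_far_le`), the landing
point `x'` of the uppermost crossing is far from `∂₁Q` (the same in the flipped frame), or both are
close — the new case, handled by the two-sided decoupling
`Charts.measureReal_crossed_not_crossed_mid_le` of `QuadCrossingExplorationJointDecoupling.lean`
with the middle closed arm in an annulus about `x` of radii `(r₁, √(r₁ R₀'))` or `(3√(r₁ R₀'), R₀')`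
(`r₁ ≍ K ρ`, `R₀' ≍ d₁(Q)`), whence the exponent `α/2`:

`P(⊞_Q Δ ⊞_{Q'}) ≤ 3 (C K ρ / d₁(Q))^{α/2} · P(⊞_{Q'})` for `K ρ ≤ c · d₁(Q)`, `ρ < d₀(Q)`
(`measureReal_symmDiff_le_mul_of_isPerturbationTwo_of_tame₃`).  Everything is proved; no named
fact is introduced.

## References

* O. Schramm, S. Smirnov, Ann. Probab. 39 (2011) 1768–1814, arXiv:1101.5820, Lemma 6.1 and its
  proof. [SchrammSmirnov2011]
* G. Grimmett, *Percolation*, 2nd ed. (1999), §11.7–11.8 (RSW, explorations). [GrimmettPercolation1999]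
-/

noncomputable section

open Set Metric Filter Function
open _root_.MeasureTheory _root_.Topology
open scoped ENNReal symmDiff
open Literature.Probability.LatticeModels
open Literature.Topology.PlaneTopology

namespace Literature.Probability.Percolation

namespace QuadCrossing

variable {D : Set ℂ}

/-! ### Arithmetic of the radii -/

/-- Sizes of the basic radii. [folklore] -/
theorem tame3_arith_basic {δ' kρ d₁ c₀ : ℝ} (hδ : 0 < δ') (hkρ : 0 < kρ) (hc₀ : 0 < c₀)
    (hδρ : δ' ≤ 2 * kρ) (hreg : 800 * (11 + 2 * c₀ + 1) * kρ ≤ d₁) :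
    0 < max (kρ + 3 * δ') (c₀ * δ') ∧
      max (kρ + 3 * δ') (c₀ * δ') + 2 * δ' ≤ (11 + 2 * c₀) * kρ ∧
      d₁ / 16 ≤ d₁ / 8 - 2 * δ' ∧
      49 * (max (kρ + 3 * δ') (c₀ * δ') + 2 * δ') ≤ d₁ / 8 - 2 * δ' ∧
      5 * δ' ≤ max (kρ + 3 * δ') (c₀ * δ') + 2 * δ' := by
  have hm₁ : kρ + 3 * δ' ≤ max (kρ + 3 * δ') (c₀ * δ') := le_max_left _ _
  have hmax : max (kρ + 3 * δ') (c₀ * δ') ≤ kρ + 3 * δ' + c₀ * δ' :=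
    max_le (by nlinarith) (by nlinarith)
  have hc₀δ : c₀ * δ' ≤ 2 * c₀ * kρ := by nlinarith
  have hr₁ : max (kρ + 3 * δ') (c₀ * δ') + 2 * δ' ≤ (11 + 2 * c₀) * kρ := by nlinarith
  refine ⟨by linarith, hr₁, by nlinarith, ?_, by linarith⟩
  nlinarith

/-- The geometric-mean parameter `q = √(r₁ / R₀')`. [folklore] -/
theorem tame3_arith_q {r₁ R₀' : ℝ} (hr₁ : 0 < r₁) (hR : 0 < R₀') (h49 : 49 * r₁ ≤ R₀') :
    0 < Real.sqrt (r₁ / R₀') ∧ Real.sqrt (r₁ / R₀') ≤ 1 / 7 ∧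
      Real.sqrt (r₁ / R₀') ^ 2 * R₀' = r₁ ∧
      7 * r₁ ≤ Real.sqrt (r₁ / R₀') * R₀' ∧ 3 * (Real.sqrt (r₁ / R₀') * R₀') ≤ R₀' := by
  set q := Real.sqrt (r₁ / R₀') with hq
  have hq0 : 0 < q := Real.sqrt_pos.2 (div_pos hr₁ hR)
  have hq7 : q ≤ 1 / 7 := by
    rw [hq, Real.sqrt_le_left (by norm_num)]
    rw [div_le_iff₀ hR]
    nlinarith
  have hq2 : q ^ 2 * R₀' = r₁ := by
    rw [hq, Real.sq_sqrt (div_nonneg hr₁.le hR.le)]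
    field_simp
  refine ⟨hq0, hq7, hq2, ?_, by nlinarith⟩
  have : 7 * r₁ = (7 * q) * (q * R₀') := by rw [← hq2]; ring
  rw [this]
  have hqR : 0 ≤ q * R₀' := by positivity
  nlinarith

/-- The hypotheses of the two-sided decoupling and of RSW for the two annulus shapes, and the two
ratio bounds. [folklore] -/
theorem tame3_arith_valid {δ' kρ d₁ c₀ r₀ q : ℝ} (hδ : 0 < δ') (hkρ : 0 < kρ)
    (hr₀k : kρ + 3 * δ' ≤ r₀) (hr₀c : c₀ * δ' ≤ r₀)
    (h49 : 49 * (r₀ + 2 * δ') ≤ d₁ / 8 - 2 * δ') (hq0 : 0 < q)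
    (hq2 : q ^ 2 * (d₁ / 8 - 2 * δ') = r₀ + 2 * δ')
    (h7 : 7 * (r₀ + 2 * δ') ≤ q * (d₁ / 8 - 2 * δ'))
    (h3 : 3 * (q * (d₁ / 8 - 2 * δ')) ≤ d₁ / 8 - 2 * δ') :
    r₀ + 2 * δ' ≤ q * (d₁ / 8 - 2 * δ') ∧
      3 * (q * (d₁ / 8 - 2 * δ')) + 2 * δ' ≤ d₁ / 8 ∧
      2 * (d₁ / 8) + 2 * (d₁ / 4) + 4 * kρ ≤ d₁ ∧
      (c₀ * δ' ≤ r₀ + 2 * δ' ∧ 2 * (r₀ + 2 * δ') ≤ q * (d₁ / 8 - 2 * δ') - 2 * δ') ∧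
      (c₀ * δ' ≤ 3 * (q * (d₁ / 8 - 2 * δ')) + 2 * δ' ∧
        2 * (3 * (q * (d₁ / 8 - 2 * δ')) + 2 * δ') ≤ d₁ / 8 - 2 * δ') ∧
      (r₀ + 2 * δ') / (q * (d₁ / 8 - 2 * δ') - 2 * δ') ≤ 4 * q ∧
      (3 * (q * (d₁ / 8 - 2 * δ')) + 2 * δ') / (d₁ / 8 - 2 * δ') ≤ 4 * q := by
  set R₀' := d₁ / 8 - 2 * δ' with hR₀'
  set r₁ := r₀ + 2 * δ' with hr₁
  set ρm := q * R₀' with hρm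
  have hR0 : 0 < R₀' := by rw [hR₀']; nlinarith
  have hr₁ρ : r₁ ≤ ρm := by nlinarith
  have hδr : 2 * δ' ≤ r₁ := by linarith
  have hρ2 : 0 < ρm - 2 * δ' := by nlinarith
  refine ⟨by linarith, by linarith, by linarith, ⟨by linarith, by nlinarith⟩,
    ⟨by nlinarith, by nlinarith⟩, ?_, ?_⟩
  · rw [div_le_iff₀ hρ2]
    have hqρ : r₁ = q * ρm := by rw [hρm, ← hq2]; ring
    have : 2 * δ' ≤ ρm / 2 := by nlinarith
    nlinarith [hq0.le]
  · rw [div_le_iff₀ hR0]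
    nlinarith

/-- The final rate: `(4q)^α ≤ (256 C₁ K ρ / d₁)^{α/2}` and `(32 C₁ K ρ / d₁)^α ≤ (256 C₁ K ρ / d₁)^{α/2}`.
[folklore] -/
theorem tame3_arith_final {δ' kρ d₁ C₁ r₁ q α : ℝ} (hα : 0 < α) (hkρ : 0 < kρ) (hC₁ : 0 < C₁)
    (hd₁ : 0 < d₁) (hq0 : 0 ≤ q) (hq2 : q ^ 2 * (d₁ / 8 - 2 * δ') = r₁) (hr₁C : r₁ ≤ C₁ * kρ)
    (hR16 : d₁ / 16 ≤ d₁ / 8 - 2 * δ') (hreg : 32 * C₁ * kρ ≤ d₁) :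
    (4 * q) ^ α ≤ (256 * C₁ * kρ / d₁) ^ (α / 2) ∧
      (32 * C₁ * kρ / d₁) ^ α ≤ (256 * C₁ * kρ / d₁) ^ (α / 2) := by
  have hR0 : 0 < d₁ / 8 - 2 * δ' := by linarith
  constructor
  · have h16 : (4 * q) ^ (2 : ℝ) ≤ 256 * C₁ * kρ / d₁ := by
      rw [Real.rpow_two, le_div_iff₀ hd₁]
      have hq2' : q ^ 2 = r₁ / (d₁ / 8 - 2 * δ') := by
        rw [eq_div_iff hR0.ne']; exact hq2
      have hq2le : q ^ 2 ≤ C₁ * kρ / (d₁ / 16) := by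
        rw [hq2']
        calc r₁ / (d₁ / 8 - 2 * δ') ≤ C₁ * kρ / (d₁ / 8 - 2 * δ') :=
              div_le_div_of_nonneg_right hr₁C hR0.le
          _ ≤ C₁ * kρ / (d₁ / 16) :=
              div_le_div_of_nonneg_left (by positivity) (by positivity) hR16
      rw [div_eq_mul_inv, show (d₁ / 16)⁻¹ = 16 / d₁ by rw [inv_div]] at hq2le
      have : q ^ 2 * d₁ ≤ 16 * C₁ * kρ := by
        have := mul_le_mul_of_nonneg_right hq2le hd₁.le
        calc q ^ 2 * d₁ ≤ C₁ * kρ * (16 / d₁) * d₁ := this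
          _ = 16 * C₁ * kρ := by field_simp
      nlinarith
    calc (4 * q) ^ α = ((4 * q) ^ (2 : ℝ)) ^ (α / 2) := by
          rw [← Real.rpow_mul (by positivity)]; congr 1; ring
      _ ≤ (256 * C₁ * kρ / d₁) ^ (α / 2) :=
          Real.rpow_le_rpow (by positivity) h16 (by positivity)
  · have ht0 : 0 < 32 * C₁ * kρ / d₁ := by positivity
    have ht1 : 32 * C₁ * kρ / d₁ ≤ 1 := by rw [div_le_one hd₁]; linarith
    calc (32 * C₁ * kρ / d₁) ^ α ≤ (32 * C₁ * kρ / d₁) ^ (α / 2) :=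
          Real.rpow_le_rpow_of_exponent_ge ht0 ht1 (by linarith)
      _ ≤ (256 * C₁ * kρ / d₁) ^ (α / 2) :=
          Real.rpow_le_rpow ht0.le (div_le_div_of_nonneg_right (by nlinarith) hd₁.le)
            (by positivity)

/-! ### The product form without the cut point -/

/-- **Schramm–Smirnov Lemma 6.1, case (2), sub-case `d = d₁`, tame quads, no cut point — product
form.**  There are `α, C, c > 0` such that for every pair `(Q, Q')` satisfying condition (2) at
scale `ρ` with `K ρ ≤ c · d₁(Q)` and `ρ < d₀(Q)`, lattice tameness of `[Q]`, the chord–arc free side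
and local star-shapedness at free-side points, and every mesh `η < ρ`,
`P_{1/2}(⊞_Q Δ ⊞_{Q'}) ≤ 3 (C K ρ / d₁(Q))^α · P_{1/2}(⊞_{Q'})` for the discrete crossing events at
mesh `η √2`. [cite: SchrammSmirnov2011, Lemma 6.1 (2) and its proof, pp. 21–23] -/
theorem measureReal_symmDiff_le_mul_of_isPerturbationTwo_of_tame₃ :
    ∃ α C c : ℝ, 0 < α ∧ 0 < C ∧ 0 < c ∧
      ∀ (D : Set ℂ) (Q Q' : Quad D) (ρ K : ℝ), 0 < ρ → 1 ≤ K → K * ρ ≤ c * Q.sideDist 1 →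
        ρ < Q.sideDist 0 → Q.IsPerturbationTwo Q' ρ →
        (∀ η : ℝ, 0 < η → η < ρ → ∀ a b : Site 2, (zdGraph 2).Adj a b →
          IsPreconnected (segment ℝ (meshPoint (η * Real.sqrt 2) a) (meshPoint (η * Real.sqrt 2) b) ∩
            Q.carrier)) →
        (∀ s t : unitInterval, dist (Q' (1, s)) (Q' (1, t)) ≤ ρ → ∀ u : unitInterval,
          ((s : ℝ) ≤ u ∧ (u : ℝ) ≤ t ∨ (t : ℝ) ≤ u ∧ (u : ℝ) ≤ s) →
            dist (Q' (1, u)) (Q' (1, s)) ≤ K * ρ) →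
        (∀ x ∈ Q'.side 2, ∃ r > 0, ∀ u ∈ Q'.carrier, u ∈ ball x r → segment ℝ x u ⊆ Q'.carrier) →
        ∀ η : ℝ, 0 < η → η < ρ →
          (bondPercolation (zdGraph 2) half).real
              (symmDiff {ω | Q ∈ z2QuadConfig D (η * Real.sqrt 2) ω}
                {ω | Q' ∈ z2QuadConfig D (η * Real.sqrt 2) ω}) ≤
            3 * ((C * K * ρ) / Q.sideDist 1) ^ α *
              (bondPercolation (zdGraph 2) half).real {ω | Q' ∈ z2QuadConfig D (η * Real.sqrt 2) ω} := by
  obtain ⟨α, c₀, hα, hc₀, hRSW⟩ := annulusDualCrossing_half_le_holds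
  set C₁ : ℝ := 11 + 2 * c₀ with hC₁
  have hC₁pos : 0 < C₁ := by rw [hC₁]; linarith
  refine ⟨α / 2, 256 * C₁, 1 / (800 * (C₁ + 1)), by positivity, by positivity, by positivity, ?_⟩
  intro D Q Q' ρ K hρ hK hρc hρ0 h2 htame harc hstar η hη hηρ
  have h2' := h2
  obtain ⟨hcar, h0, h1, h3, hjoin⟩ := h2
  set d₁ := Q.sideDist 1 with hd₁
  have hd₁pos : 0 < d₁ := Q.sideDist_pos 1
  have hKpos : 0 < K := by linarith
  have hKρ : ρ ≤ K * ρ := by nlinarith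
  have hkρ : 0 < K * ρ := by positivity
  -- the regime
  have hρd : 800 * (C₁ + 1) * (K * ρ) ≤ d₁ := by
    have := hρc
    rw [div_mul_eq_mul_div, one_mul, le_div_iff₀ (by positivity)] at this
    linarith
  have hCk : 0 ≤ C₁ * (K * ρ) := by positivity
  have hc₀k : 0 ≤ c₀ * (K * ρ) := by positivity
  have hk800 : 800 * (K * ρ) ≤ d₁ := by linarith
  have h32 : 32 * C₁ * (K * ρ) ≤ d₁ := by linarith
  -- the frame (mesh `δ' = η √2`)
  have hsqrt2 : Real.sqrt 2 < 2 := by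
    rw [show (2 : ℝ) = Real.sqrt 4 by rw [show (4 : ℝ) = 2 ^ 2 by norm_num, Real.sqrt_sq (by norm_num)]]
    exact Real.sqrt_lt_sqrt (by norm_num) (by norm_num)
  obtain ⟨Φ, hΦ, hΦδ, hΦa, hΦb, hΦc, hΦd, hG⟩ :=
    Q'.exists_frame_charts' (mul_pos hη (Real.sqrt_pos.2 (by norm_num)) : 0 < η * Real.sqrt 2)
  have hδ'pos : 0 < Φ.δ := Φ.hδ
  have hδ'ρ : Φ.δ < 2 * ρ := by
    rw [hΦδ]
    calc η * Real.sqrt 2 < ρ * 2 := mul_lt_mul'' hηρ hsqrt2 hη.le (Real.sqrt_nonneg _)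
      _ = 2 * ρ := by ring
  have hδ'k : Φ.δ ≤ 2 * (K * ρ) := by linarith
  have htame' : ∀ a b : Site 2, (zdGraph 2).Adj a b →
      IsPreconnected (segment ℝ (meshPoint Φ.δ a) (meshPoint Φ.δ b) ∩ Q.carrier) := by
    rw [hΦδ]; exact htame η hη hηρ
  have hΦT : Φ.flipFrame.Charts Q'.flip := SSContinuity.Frame.Charts.flipFrame Φ hΦ
  have hGT := Φ.flipFrame_chart (Q' := Q') hG
  -- Step 1: the discrete events
  rw [← hΦδ]
  set μ := bondPercolation (zdGraph 2) half with hμ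
  set A : Set (BondConfig (Site 2)) := {ω | Q ∈ z2QuadConfig D Φ.δ ω} with hA
  set B : Set (BondConfig (Site 2)) := {ω | Q' ∈ z2QuadConfig D Φ.δ ω} with hB
  set Bx : Set (BondConfig (Site 2)) := {ω | ∃ K', Q'.IsCrossing K' ∧ K' ⊆ openEdgeUnion Φ.δ ω}
    with hBx
  have hBBx : B = Bx := by
    ext ω; rw [hB, mem_setOf_eq, mem_z2QuadConfig_iff_exists_isCrossing hδ'pos]; rfl
  have hAx : A = {ω | ∃ K, Q.IsCrossing K ∧ K ⊆ openEdgeUnion Φ.δ ω} := by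
    ext ω; rw [hA, mem_setOf_eq, mem_z2QuadConfig_iff_exists_isCrossing hδ'pos]; rfl
  have hAB : A ⊆ B := fun ω hω => by
    rw [hAx] at hω
    obtain ⟨K₀, hK₀, hK₀O⟩ := hω
    rw [hBBx]
    exact Quad.exists_isCrossing_subquad_of_isCrossing hcar h0 h1 h3 hδ'pos hK₀ hK₀O
  -- the three events
  set c₃ : ℝ := d₁ / 4 with hc₃
  set Ea : Set (BondConfig (Site 2)) := {ω | (∃ K', Q'.IsCrossing K' ∧ K' ⊆ openEdgeUnion Φ.δ ω) ∧
      (¬ ∃ K, Q.IsCrossing K ∧ K ⊆ openEdgeUnion Φ.δ ω) ∧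
      ∀ t ∈ Q.side 3, ∀ p : Path (Φ.G (Φ.wallPt ω)) t, range p ⊆ Q.carrier →
        c₃ ≤ Metric.diam (range p)} with hEa
  set Eb : Set (BondConfig (Site 2)) := {ω | (∃ K', Q'.flip.IsCrossing K' ∧
      K' ⊆ openEdgeUnion Φ.flipFrame.δ ω) ∧
      (¬ ∃ K, Q.flip.IsCrossing K ∧ K ⊆ openEdgeUnion Φ.flipFrame.δ ω) ∧
      ∀ t ∈ Q.flip.side 3, ∀ p : Path (Φ.flipFrame.G (Φ.flipFrame.wallPt ω)) t,
        range p ⊆ Q.flip.carrier → c₃ ≤ Metric.diam (range p)} with hEb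
  set Ec : Set (BondConfig (Site 2)) := {ω | (∃ K', Q'.IsCrossing K' ∧ K' ⊆ openEdgeUnion Φ.δ ω) ∧
      (¬ ∃ K, Q.IsCrossing K ∧ K ⊆ openEdgeUnion Φ.δ ω) ∧
      (∃ t ∈ Q.side 3, ∃ p : Path (Φ.G (Φ.wallPt ω)) t,
        range p ⊆ Q.carrier ∧ Metric.diam (range p) < c₃) ∧
      ∃ t ∈ Q.side 1, ∃ p : Path (Φ.flipFrame.G (Φ.flipFrame.wallPt ω)) t,
        range p ⊆ Q.carrier ∧ Metric.diam (range p) < c₃} with hEc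
  -- Step 2: the trichotomy `B ∖ A ⊆ Ea ∪ Eb ∪ Ec`
  have hsplit : symmDiff A B ⊆ Ea ∪ Eb ∪ Ec := by
    intro ω hω
    have hωB : ω ∈ B := by
      rcases (Set.mem_symmDiff).1 hω with ⟨hωA, -⟩ | ⟨hωB, -⟩
      · exact hAB hωA
      · exact hωB
    have hωA : ω ∉ A := by
      rcases (Set.mem_symmDiff).1 hω with ⟨-, hnB⟩ | ⟨-, hnA⟩
      · exact absurd hωB hnB
      · exact hnA
    rw [hBBx] at hωB
    rw [hAx] at hωA
    obtain ⟨K', hK', hK'O⟩ := hωB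
    have hK'T : Q'.flip.IsCrossing K' := (Quad.flip_isCrossing_iff Q' K').2 hK'
    by_cases hfar₃ : ∀ t ∈ Q.side 3, ∀ p : Path (Φ.G (Φ.wallPt ω)) t, range p ⊆ Q.carrier →
        c₃ ≤ Metric.diam (range p)
    · exact Or.inl (Or.inl ⟨⟨K', hK', hK'O⟩, hωA, hfar₃⟩)
    push Not at hfar₃
    by_cases hfar₁ : ∀ t ∈ Q.side 1, ∀ p : Path (Φ.flipFrame.G (Φ.flipFrame.wallPt ω)) t,
        range p ⊆ Q.carrier → c₃ ≤ Metric.diam (range p)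
    · refine Or.inl (Or.inr ⟨⟨K', hK'T, hK'O⟩, ?_, fun t ht p hp => ?_⟩)
      · rintro ⟨K₀, hK₀, hK₀O⟩
        exact hωA ⟨K₀, (Quad.flip_isCrossing_iff Q K₀).1 hK₀, hK₀O⟩
      · rw [Quad.flip_side_three] at ht
        rw [Quad.flip_carrier] at hp
        exact hfar₁ t ht p hp
    · push Not at hfar₁
      obtain ⟨t₃, ht₃, p₃, hp₃, hp₃d⟩ := hfar₃
      obtain ⟨t₁, ht₁, p₁, hp₁, hp₁d⟩ := hfar₁
      exact Or.inr ⟨⟨K', hK', hK'O⟩, hωA, ⟨t₃, ht₃, p₃, hp₃, hp₃d⟩, ⟨t₁, ht₁, p₁, hp₁, hp₁d⟩⟩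
  -- Step 3: the radii and the RSW bounds
  -- (a) the far cases
  set r : ℝ := max (K * ρ + 5 * Φ.δ) (c₀ * Φ.δ) with hr
  set R : ℝ := c₃ / 2 - 2 * Φ.δ with hR
  have hc₀δ : c₀ * Φ.δ ≤ c₀ * (2 * (K * ρ)) := mul_le_mul_of_nonneg_left hδ'k hc₀.le
  have hrle : r ≤ C₁ * (K * ρ) := by
    rw [hr, max_le_iff, hC₁]
    constructor
    · linarith
    · linarith
  have hr0 : 0 < r := lt_of_lt_of_le (by positivity) (le_max_left _ _)
  have hRge : d₁ / 16 ≤ R := by rw [hR, hc₃]; linarith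
  have hrc : K * ρ + 5 * Φ.δ ≤ c₃ / 2 := by rw [hc₃]; linarith
  have h2r : 2 * r ≤ R := by linarith
  set ηb : ℝ := (r / R) ^ α with hηb
  have hηb0 : 0 ≤ ηb := Real.rpow_nonneg (div_nonneg hr0.le (by linarith)) _
  have hRSW' : ∀ x : ℂ, μ.real (annulusDualCrossing x Φ.δ r (c₃ / 2 - 2 * Φ.δ)) ≤ ηb := fun x =>
    hRSW x Φ.δ r R hδ'pos (le_max_right _ _) h2r
  -- (b) the middle case
  set r₀ : ℝ := max (K * ρ + 3 * Φ.δ) (c₀ * Φ.δ) with hr₀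
  have hreg' : 800 * (11 + 2 * c₀ + 1) * (K * ρ) ≤ d₁ := by
    have := hρd
    simp only [hC₁] at this
    exact this
  obtain ⟨hr₀pos, hr₁C, hR16, h49, -⟩ := tame3_arith_basic hδ'pos hkρ hc₀ hδ'k hreg'
  have hr₁pos : 0 < r₀ + 2 * Φ.δ := by linarith
  have hR0' : 0 < d₁ / 8 - 2 * Φ.δ := by linarith
  obtain ⟨hq0, -, hq2, h7, h3q⟩ := tame3_arith_q hr₁pos hR0' h49
  set q : ℝ := Real.sqrt ((r₀ + 2 * Φ.δ) / (d₁ / 8 - 2 * Φ.δ)) with hq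
  obtain ⟨hslack₁, hslack₂, hR₀, ⟨hv₁, hv₁'⟩, ⟨hv₂, hv₂'⟩, hrat₁, hrat₂⟩ :=
    tame3_arith_valid (d₁ := d₁) hδ'pos hkρ (le_max_left _ _) (le_max_right _ _) h49 hq0 hq2 h7 h3q
  set ρm : ℝ := q * (d₁ / 8 - 2 * Φ.δ) with hρm
  set R₀ : ℝ := d₁ / 8 with hR₀def
  set ηc : ℝ := (4 * q) ^ α with hηc
  have h4q : (0 : ℝ) ≤ 4 * q := by linarith [hq0.le]
  have hηc0 : 0 ≤ ηc := Real.rpow_nonneg h4q _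
  have hρm0 : 0 < ρm := mul_pos hq0 hR0'
  have hρm2 : 0 < ρm - 2 * Φ.δ := by
    have : r₀ + 2 * Φ.δ ≤ ρm := hslack₁
    linarith
  have hRSWc : ∀ x : ℂ, μ.real (annulusDualCrossing x Φ.δ (r₀ + 2 * Φ.δ) (ρm - 2 * Φ.δ)) ≤ ηc ∧
      μ.real (annulusDualCrossing x Φ.δ (3 * ρm + 2 * Φ.δ) (R₀ - 2 * Φ.δ)) ≤ ηc := by
    intro x
    constructor
    · refine (hRSW x Φ.δ (r₀ + 2 * Φ.δ) (ρm - 2 * Φ.δ) hδ'pos hv₁ hv₁').trans ?_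
      exact Real.rpow_le_rpow (div_nonneg hr₁pos.le hρm2.le) hrat₁ hα.le
    · refine (hRSW x Φ.δ (3 * ρm + 2 * Φ.δ) (R₀ - 2 * Φ.δ) hδ'pos hv₂ hv₂').trans ?_
      exact Real.rpow_le_rpow (div_nonneg (by linarith) hR0'.le) hrat₂ hα.le
  -- Step 4: the three decoupling bounds (product form)
  have hEa : μ.real Ea ≤ ηb * μ.real B := by
    have := SSContinuity.Frame.Charts.measureReal_crossed_not_crossed_far_le hΦ hΦb hΦc hΦd hG hcar
      h0 h1 hρ hρ0 hjoin htame' hK harc (le_max_left _ _) hrc hηb0 hRSW'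
    rw [hBBx]
    exact this
  have hEb : μ.real Eb ≤ ηb * μ.real B := by
    obtain ⟨-, -, -, -, hjoinT⟩ := Quad.IsPerturbationTwo.flip h2'
    have hcarT : Q'.flip.carrier ⊆ Q.flip.carrier := by simpa using hcar
    have h0T : Q'.flip.side 0 = Q.flip.side 0 := by simpa using h0
    have h1T : Q'.flip.side 1 ⊆ Q.flip.side 1 := by simpa using h3
    have hρ0T : ρ < Q.flip.sideDist 0 := by rwa [Quad.flip_sideDist_zero]
    have htameT : ∀ a b : Site 2, (zdGraph 2).Adj a b →
        IsPreconnected (segment ℝ (meshPoint Φ.flipFrame.δ a) (meshPoint Φ.flipFrame.δ b) ∩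
          Q.flip.carrier) := by
      rw [Quad.flip_carrier]; exact htame'
    have := SSContinuity.Frame.Charts.measureReal_crossed_not_crossed_far_le hΦT
      (by simp [hΦb]) (by simp [hΦd]) (by simp [hΦc]) hGT hcarT h0T h1T hρ hρ0T hjoinT htameT hK
      (Quad.flip_arc harc) (le_max_left _ _) hrc hηb0 hRSW'
    have hBT : {ω | ∃ K', Q'.flip.IsCrossing K' ∧ K' ⊆ openEdgeUnion Φ.flipFrame.δ ω} = B := by
      rw [hBBx]
      ext ω
      simp only [mem_setOf_eq]
      constructor
      · rintro ⟨K', hK', hK'O⟩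
        exact ⟨K', (Quad.flip_isCrossing_iff Q' K').1 hK', hK'O⟩
      · rintro ⟨K', hK', hK'O⟩
        exact ⟨K', (Quad.flip_isCrossing_iff Q' K').2 hK', hK'O⟩
    rw [hBT] at this
    exact this
  have hEc : μ.real Ec ≤ ηc * μ.real B := by
    have := SSContinuity.Frame.Charts.measureReal_crossed_not_crossed_mid_le hΦ hΦb hΦc hΦd hG hcar
      h0 h1 h3 hρ hρ0 hjoin htame' hK harc hstar (le_max_left _ _) hslack₁ hslack₂ hR₀ hηc0 hRSWc
    rw [hBBx]
    exact this
  -- Step 5: assemble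
  have hmono : μ.real (symmDiff A B) ≤ μ.real (Ea ∪ Eb ∪ Ec) :=
    measureReal_mono hsplit (measure_ne_top _ _)
  have hunion : μ.real (Ea ∪ Eb ∪ Ec) ≤ μ.real Ea + μ.real Eb + μ.real Ec :=
    (measureReal_union_le _ Ec).trans (by linarith [measureReal_union_le (μ := μ) Ea Eb])
  refine hmono.trans (hunion.trans ?_)
  obtain ⟨hfinc, hfinb⟩ := tame3_arith_final (δ' := Φ.δ) hα hkρ hC₁pos hd₁pos hq0.le hq2 hr₁C hR16
    h32
  have hbase : r / R ≤ 32 * C₁ * (K * ρ) / d₁ := by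
    rw [div_le_div_iff₀ (by linarith) hd₁pos]
    calc r * d₁ ≤ C₁ * (K * ρ) * d₁ := mul_le_mul_of_nonneg_right hrle hd₁pos.le
      _ = 32 * C₁ * (K * ρ) * (d₁ / 32) := by ring
      _ ≤ 32 * C₁ * (K * ρ) * R := by
          apply mul_le_mul_of_nonneg_left (by linarith) (by positivity)
  have hpowb : ηb ≤ (256 * C₁ * (K * ρ) / d₁) ^ (α / 2) :=
    (Real.rpow_le_rpow (div_nonneg hr0.le (by linarith)) hbase hα.le).trans hfinb
  have hpowc : ηc ≤ (256 * C₁ * (K * ρ) / d₁) ^ (α / 2) := hfinc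
  have heq : (256 * C₁ * K * ρ) / d₁ = 256 * C₁ * (K * ρ) / d₁ := by ring
  rw [heq]
  have hB0 : 0 ≤ μ.real B := measureReal_nonneg
  have hb' : ηb * μ.real B ≤ (256 * C₁ * (K * ρ) / d₁) ^ (α / 2) * μ.real B :=
    mul_le_mul_of_nonneg_right hpowb hB0
  have hc' : ηc * μ.real B ≤ (256 * C₁ * (K * ρ) / d₁) ^ (α / 2) * μ.real B :=
    mul_le_mul_of_nonneg_right hpowc hB0
  linarith

end QuadCrossing

end Literature.Probability.Percolation
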